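import Summits.AtomisticToContinuum.BoseEinsteinCondensation.Theorems.BECInfDivCoherenceLevyNegativeMomentTargetStrength
import Summits.AtomisticToContinuum.BoseEinsteinCondensation.Theorems.BECInfDivCoherenceLevyNegativeMomentCoherencePosBounded
import HarnessLib

/-!
# Crux `LevyNegativeMoment` (stmt-AtomisticToContinuum-9115) — the crux is target-strength
# UNCONDITIONALLY on the bounded sector (route `BECInfDivCoherence`, line `registered`, lead cycle 3;
# supports, does not close, the crux)

Sequel of `…LevyNegativeMomentTargetStrength.lean` (lead c2: crux + `CoherencePos` ⟹ route target) and
`…LevyNegativeMomentCoherencePosBounded.lean` (lead c3: `CoherencePos` holds for bounded admissible `v`).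
Everything here is per potential `v`:

* `periodicBEC_clause_of_gridMeanLog_of_coherencePos` — c2's
  `periodicBEC_of_gridMeanLog_of_coherencePos` with its two hypotheses localised at one admissible `v`
  (same proof: AM–GM on the `η = 1` grid, `GridAverageCondensate`, Dyson–LSSY ceiling `E₀ ≤ 16πRρN`).
* `coherencePos_clause_of_bounded` — along `L_N = (N/ρ)^{1/3}`, for bounded admissible `v`, every
  density: eventually in `N` some `δ_N > 0` makes every `δ_N`-near-minimiser have `G > 0` everywhere
  (`CoherencePos.coherencePos_of_bounded` at each `N ≥ 1`).
* `periodicBEC_clause_of_levyNegativeMoment_bounded` — **`LevyNegativeMoment` ALONE implies, for every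
  BOUNDED repulsive finite-range `v`, the `PeriodicBEC` clause of `v`** (constant-mode condensation
  `condensateOccupation ≥ cN` of all near-minimisers on the torus at every small density): the crux is at
  least the bounded sector of the open sub-problem (stmt-0826), with no side hypothesis left.
* `periodicBEC_clause_of_logClusterL1_bounded` — the same for the registered stub `stub_logClusterL1`
  (inline, verbatim its registered signature): the stub is at least the bounded sector of the target.
* `periodicBEC_bounded_of_levyNegativeMoment` — packaged: `LevyNegativeMoment →` (PeriodicBEC restricted
  to bounded admissible potentials).
* `hasGroundStateBEC_bounded_of_levyNegativeMoment_of_boundaryTransferWeak` — with the route's own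
  `BoundaryTransferWeak` (stmt-0827): `LevyNegativeMoment → BoundaryTransferWeak →` the summit conjunct's
  `HasGroundStateBEC v ρ` at all small `ρ` for every bounded admissible `v`; the sister crux
  `GridInfDivCoherence` is idle on the bounded sector.

No claim is made about the truth of the crux or of the stub; hard cores / unbounded `v` are not covered
(there `CoherencePos` needs the nondegeneracy of the periodic ground state for `⊤`-valued potentials,
not in the tree).
-/

noncomputable section

namespace Summit.AtomisticToContinuum.BoseEinsteinCondensation.Theorems

open MeasureTheory Filter Literature.MathematicalPhysics.QuantumManyBody.BoseGas InfDivGlue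
open scoped ENNReal NNReal ComplexConjugate

/-! ### The certificate, localised at one potential -/

/-- **Constant-mode BEC from a uniform grid-mean floor of `log G_Ψ` and positivity of the coherence, at
one admissible potential** (c2's `periodicBEC_of_gridMeanLog_of_coherencePos` with both hypotheses
localised at `v`; only the grid scale `η = 1` of the floor is used). [folklore] -/
theorem periodicBEC_clause_of_gridMeanLog_of_coherencePos {v : ℝ → ℝ≥0∞} (hv : IsRepulsiveFiniteRange v)
    (hpos : ∃ ρ₀ : ℝ, 0 < ρ₀ ∧
      ∀ ρ : ℝ, 0 < ρ → ρ < ρ₀ → ∀ᶠ N : ℕ in atTop, ∃ δ : ℝ≥0∞, 0 < δ ∧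
        ∀ Ψ : PeriodicTrialState N (sideLength ρ N),
          periodicEnergy v Ψ ≤ periodicGroundStateEnergy v N (sideLength ρ N) + δ → ∀ i : Fin N,
            ∀ r, 0 < (∫ X in cellN N (sideLength ρ N),
              conj (Ψ.ψ (Function.update X i (X i + r))) * Ψ.ψ X).re)
    (hmean : ∀ η : ℝ, 0 < η → ∃ Λ : ℝ, ∃ ρ₀ : ℝ, 0 < ρ₀ ∧
      ∀ ρ : ℝ, 0 < ρ → ρ < ρ₀ → ∀ᶠ N : ℕ in atTop, ∃ δ : ℝ≥0∞, 0 < δ ∧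
        ∀ Ψ : PeriodicTrialState N (sideLength ρ N),
          periodicEnergy v Ψ ≤ periodicGroundStateEnergy v N (sideLength ρ N) + δ → ∀ i : Fin N,
            let L : ℝ := sideLength ρ N; let m : ℕ := ⌊L / η⌋₊;
            -Λ ≤ (∑ j : Fin 3 → Fin m, Real.log ((∫ X in cellN N L,
              conj (Ψ.ψ (Function.update X i (X i + latticeVec (L / m) (fun k => ((j k : ℕ) : ℤ))))) *
                Ψ.ψ X).re)) / (m : ℝ) ^ 3)
    (h4 : Summit.AtomisticToContinuum.BoseEinsteinCondensation.Theses.BECInfDivCoherence.GridAverageCondensate) :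
    ∃ ρ₀ : ℝ, 0 < ρ₀ ∧ ∀ ρ : ℝ, 0 < ρ → ρ < ρ₀ →
      ∃ c : ℝ, 0 < c ∧ ∀ᶠ N : ℕ in atTop, ∃ δ : ℝ≥0∞, 0 < δ ∧
        ∀ Ψ : PeriodicTrialState N (sideLength ρ N),
          periodicEnergy v Ψ ≤ periodicGroundStateEnergy v N (sideLength ρ N) + δ →
            ENNReal.ofReal (c * N) ≤ condensateOccupation N (sideLength ρ N) Ψ.ψ := by
  obtain ⟨R₀, hR₀⟩ := hv.2
  -- a positive range bound
  set R : ℝ := max R₀ 1 with hRdef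
  have hR : 0 < R := lt_max_of_lt_right one_pos
  have hvR : ∀ r, R < r → v r = 0 := fun r hr => hR₀ r ((le_max_left _ _).trans_lt hr)
  obtain ⟨ρ₁, hρ₁, H1⟩ := hpos
  obtain ⟨Λ, ρ₂, hρ₂, H2⟩ := hmean 1 one_pos
  obtain ⟨ρ₃, hρ₃, H3⟩ := periodicGroundStateEnergy_le_uniform hR
  -- constants
  set c : ℝ := Real.exp (-Λ) / 2 with hc
  have hcpos : 0 < c := by positivity
  set κ : ℝ := c / 2 with hκ
  have hκpos : 0 < κ := by positivity
  set ρ₄ : ℝ := κ / (16 * Real.pi * R) with hρ₄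
  have hρ₄pos : 0 < ρ₄ := by positivity
  refine ⟨min (min ρ₁ ρ₂) (min ρ₃ ρ₄), by positivity, fun ρ hρ hρlt => ?_⟩
  have hρ1 : ρ < ρ₁ := hρlt.trans_le ((min_le_left _ _).trans (min_le_left _ _))
  have hρ2 : ρ < ρ₂ := hρlt.trans_le ((min_le_left _ _).trans (min_le_right _ _))
  have hρ3 : ρ < ρ₃ := hρlt.trans_le ((min_le_right _ _).trans (min_le_left _ _))
  have hρ4 : ρ < ρ₄ := hρlt.trans_le ((min_le_right _ _).trans (min_le_right _ _))
  -- the energy per particle `e = 16πRρ < κ`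
  set e : ℝ := 16 * Real.pi * R * ρ with he
  have hepos : 0 ≤ e := by positivity
  have heκ : e < κ := by
    have : 16 * Real.pi * R * ρ < 16 * Real.pi * R * (κ / (16 * Real.pi * R)) :=
      mul_lt_mul_of_pos_left hρ4 (by positivity)
    rwa [mul_div_cancel₀ _ (by positivity : (16 * Real.pi * R : ℝ) ≠ 0)] at this
  refine ⟨c, hcpos, ?_⟩
  have hNκ : ∀ᶠ N : ℕ in atTop, (1 : ℝ) / N ≤ κ :=
    tendsto_one_div_atTop_nhds_zero_nat.eventually (eventually_le_nhds hκpos)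
  filter_upwards [H1 ρ hρ hρ1, H2 ρ hρ hρ2, H3 ρ hρ hρ3, eventually_ge_atTop 1, hNκ,
    (tendsto_sideLength_atTop hρ).eventually_ge_atTop 1] with N hN1 hN2 hN3 hN1le hNκ' hL1
  have hN0 : 0 < N := by omega
  have hNpos : (0 : ℝ) < N := by exact_mod_cast hN0
  have hE0 : periodicGroundStateEnergy v N (sideLength ρ N) ≤ ENNReal.ofReal (e * N) := by
    have := hN3 v hvR; rwa [he]
  have hLpos : 0 < sideLength ρ N := by
    unfold sideLength; exact Real.rpow_pos_of_pos (div_pos hNpos hρ) _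
  have heN : e + 1 / N ≤ 2 * κ := by linarith
  clear hN3 H1 H2 H3
  dsimp only at hN2
  generalize sideLength ρ N = L at hN1 hN2 hE0 hLpos hL1 ⊢
  -- the grid size `m = ⌊L/1⌋ ≥ 1` and spacing `h = L/m ≤ 2`
  have hm1 : 1 ≤ ⌊L / 1⌋₊ := Nat.le_floor (by rw [Nat.cast_one, div_one]; exact hL1)
  have hmlt : L / 1 < ⌊L / 1⌋₊ + 1 := Nat.lt_floor_add_one _
  generalize hmdef : ⌊L / 1⌋₊ = m at hN2 hm1 hmlt
  haveI : NeZero m := ⟨by omega⟩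
  have hm0 : 0 < m := by omega
  have hmpos : (0 : ℝ) < m := by exact_mod_cast hm0
  have hm1r : (1 : ℝ) ≤ m := by exact_mod_cast hm1
  set h : ℝ := L / m with hh
  have hhpos : 0 < h := div_pos hLpos hmpos
  have hh2 : h ≤ 2 := by
    rw [hh, div_le_iff₀ hmpos]
    rw [div_one] at hmlt
    nlinarith
  have hh2sq : h ^ 2 ≤ 4 := by nlinarith
  obtain ⟨δ₁, hδ₁, H1'⟩ := hN1
  obtain ⟨δ₂, hδ₂, H2'⟩ := hN2
  refine ⟨min (min δ₁ δ₂) 1, lt_min (lt_min hδ₁ hδ₂) one_pos, fun Ψ hΨ => ?_⟩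
  have hΨ1 : periodicEnergy v Ψ ≤ periodicGroundStateEnergy v N L + δ₁ :=
    hΨ.trans (add_le_add le_rfl ((min_le_left _ _).trans (min_le_left _ _)))
  have hΨ2 : periodicEnergy v Ψ ≤ periodicGroundStateEnergy v N L + δ₂ :=
    hΨ.trans (add_le_add le_rfl ((min_le_left _ _).trans (min_le_right _ _)))
  -- kinetic energy `≤ eN + 1`
  set T : ℝ := e * N + 1 with hT
  have hTpos : 0 ≤ T := by positivity
  have hkin : (∫⁻ X in cellN N L, kineticDensity Ψ.ψ X) ≤ ENNReal.ofReal T :=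
    calc (∫⁻ X in cellN N L, kineticDensity Ψ.ψ X) ≤ periodicEnergy v Ψ :=
          lintegral_kineticDensity_le_periodicEnergy v Ψ
      _ ≤ periodicGroundStateEnergy v N L + min (min δ₁ δ₂) 1 := hΨ
      _ ≤ ENNReal.ofReal (e * N) + 1 := add_le_add hE0 (min_le_right _ _)
      _ = ENNReal.ofReal T := by
          rw [hT, ENNReal.ofReal_add (by positivity) zero_le_one, ENNReal.ofReal_one]
  -- any particle will do: take `i = 0`
  set i : Fin N := ⟨0, hN0⟩ with hi
  set G : Space → ℝ := fun r =>
    (∫ X in cellN N L, conj (Ψ.ψ (Function.update X i (X i + r))) * Ψ.ψ X).re with hGdef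
  have hGpos : ∀ r, 0 < G r := H1' Ψ hΨ1 i
  have hmeanF : -Λ ≤ (∑ j : Fin 3 → Fin m,
      Real.log (G (latticeVec h fun k => ((j k : ℕ) : ℤ)))) / (m : ℝ) ^ 3 := H2' Ψ hΨ2 i
  have h4i : ENNReal.ofReal (N * (∑ j : Fin 3 → Fin m, G (latticeVec h fun k => ((j k : ℕ) : ℤ))) /
      (m : ℝ) ^ 3 - T * h ^ 2 / (4 * Real.pi ^ 2)) ≤ condensateOccupation N L Ψ.ψ :=
    h4 N m L T hLpos hm0 hTpos Ψ hkin i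
  clear_value G
  -- AM–GM: grid average of `G` is at least `exp(mean log G) ≥ exp(-Λ) = 2c`
  have havg : 2 * c ≤ (∑ j : Fin 3 → Fin m, G (latticeVec h fun k => ((j k : ℕ) : ℤ))) / (m : ℝ) ^ 3 := by
    have hJ := exp_mean_log_le_mean (fun j : Fin 3 → Fin m => G (latticeVec h fun k => ((j k : ℕ) : ℤ)))
      (fun j => hGpos _)
    have hcard : (Fintype.card (Fin 3 → Fin m) : ℝ) = (m : ℝ) ^ 3 := by
      rw [Fintype.card_fun, Fintype.card_fin, Fintype.card_fin, Nat.cast_pow]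
    rw [hcard] at hJ
    calc 2 * c = Real.exp (-Λ) := by rw [hc]; ring
      _ ≤ Real.exp ((∑ j : Fin 3 → Fin m,
          Real.log (G (latticeVec h fun k => ((j k : ℕ) : ℤ)))) / (m : ℝ) ^ 3) :=
          Real.exp_le_exp.2 hmeanF
      _ ≤ _ := hJ
  -- `GridAverageCondensate` and the error term `T h²/(4π²) ≤ c N`
  refine le_trans (ENNReal.ofReal_le_ofReal ?_) h4i
  have hπ : 1 ≤ Real.pi ^ 2 := one_le_pow₀ (by linarith only [Real.pi_gt_three])
  have hTerr : T * h ^ 2 / (4 * Real.pi ^ 2) ≤ c * N := by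
    have hTh : 0 ≤ T * h ^ 2 := by positivity
    calc T * h ^ 2 / (4 * Real.pi ^ 2) ≤ T * h ^ 2 / 4 :=
          div_le_div_of_nonneg_left hTh (by norm_num) (by linarith only [hπ])
      _ ≤ T := by
          have := mul_le_mul_of_nonneg_left hh2sq hTpos; linarith only [this]
      _ = N * (e + 1 / N) := by rw [hT]; field_simp
      _ ≤ N * (2 * κ) := by gcongr
      _ = c * N := by rw [hκ]; ring
  have hmain := mul_le_mul_of_nonneg_left havg hNpos.le
  rw [mul_div_assoc]
  linarith only [hmain, hTerr]

/-! ### Positivity along the thermodynamic sequence, bounded class -/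

/-- **Positivity of the coherence of near-minimisers along `L_N = (N/ρ)^{1/3}`, bounded admissible
class**: for `v ≤ M < ∞` admissible and every `ρ > 0`, for all `N ≥ 1` there is `δ_N > 0` such that
every `δ_N`-near-minimiser of the periodic `N`-body energy on the torus of side `(N/ρ)^{1/3}` has
`G > 0` at every particle and every `r` (`CoherencePos.coherencePos_of_bounded` at each `N`; the density
threshold `ρ₀ = 1` is idle). [folklore] -/
theorem coherencePos_clause_of_bounded {v : ℝ → ℝ≥0∞} (hv : IsRepulsiveFiniteRange v) {M : ℝ≥0}
    (hM : ∀ r, v r ≤ M) :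
    ∃ ρ₀ : ℝ, 0 < ρ₀ ∧
      ∀ ρ : ℝ, 0 < ρ → ρ < ρ₀ → ∀ᶠ N : ℕ in atTop, ∃ δ : ℝ≥0∞, 0 < δ ∧
        ∀ Ψ : PeriodicTrialState N (sideLength ρ N),
          periodicEnergy v Ψ ≤ periodicGroundStateEnergy v N (sideLength ρ N) + δ → ∀ i : Fin N,
            ∀ r, 0 < (∫ X in cellN N (sideLength ρ N),
              conj (Ψ.ψ (Function.update X i (X i + r))) * Ψ.ψ X).re := by
  refine ⟨1, one_pos, fun ρ hρ _ => ?_⟩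
  filter_upwards [eventually_gt_atTop 0] with N hN
  have hLpos : 0 < sideLength ρ N := by
    unfold sideLength
    exact Real.rpow_pos_of_pos (div_pos (by exact_mod_cast hN) hρ) _
  exact CoherencePos.coherencePos_of_bounded hv hM N hLpos

/-! ### The crux and the stub are target-strength on the bounded sector, unconditionally -/

/-- **`LevyNegativeMoment` alone yields the `PeriodicBEC` clause of every BOUNDED admissible potential.**
If the crux holds then for every repulsive finite-range measurable `v` with `v ≤ M < ∞` there is `ρ₀ > 0`
such that for `0 < ρ < ρ₀` some `c > 0` bounds the constant-mode occupation of all near-minimisers on the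
torus from below, `condensateOccupation ≥ cN`, for all large `N` — verbatim the clause of
`BECPeriodicReduction.PeriodicBEC` (stmt-0826) at `v`. Composition of the grid-mean floor from the crux
(`gridMeanLog_of_levyNegativeMoment`), positivity on the bounded class (`coherencePos_clause_of_bounded`)
and the proved support `GridAverageCondensate`. [folklore] -/
theorem periodicBEC_clause_of_levyNegativeMoment_bounded
    (h2 : Summit.AtomisticToContinuum.BoseEinsteinCondensation.Theses.BECInfDivCoherence.LevyNegativeMoment)
    {v : ℝ → ℝ≥0∞} (hv : IsRepulsiveFiniteRange v) {M : ℝ≥0} (hM : ∀ r, v r ≤ M) :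
    ∃ ρ₀ : ℝ, 0 < ρ₀ ∧ ∀ ρ : ℝ, 0 < ρ → ρ < ρ₀ →
      ∃ c : ℝ, 0 < c ∧ ∀ᶠ N : ℕ in atTop, ∃ δ : ℝ≥0∞, 0 < δ ∧
        ∀ Ψ : PeriodicTrialState N (sideLength ρ N),
          periodicEnergy v Ψ ≤ periodicGroundStateEnergy v N (sideLength ρ N) + δ →
            ENNReal.ofReal (c * N) ≤ condensateOccupation N (sideLength ρ N) Ψ.ψ :=
  periodicBEC_clause_of_gridMeanLog_of_coherencePos hv (coherencePos_clause_of_bounded hv hM)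
    (gridMeanLog_of_levyNegativeMoment h2 v hv) gridAverageCondensate_proof

/-- **The registered stub `stub_logClusterL1` alone yields the `PeriodicBEC` clause of every BOUNDED
admissible potential** (the stub's registered signature inline, verbatim): composition of
`gridMeanLog_of_logClusterL1`, `coherencePos_clause_of_bounded` and `gridAverageCondensate_proof`.
[folklore] -/
theorem periodicBEC_clause_of_logClusterL1_bounded
    (h1 : ∀ v : ℝ → ENNReal, Literature.MathematicalPhysics.QuantumManyBody.BoseGas.IsRepulsiveFiniteRange v → ∀ η : ℝ, 0 < η → ∃ C : ℝ, ∃ ρ₀ : ℝ, 0 < ρ₀ ∧ ∀ ρ : ℝ, 0 < ρ → ρ < ρ₀ → ∀ᶠ N : ℕ in Filter.atTop, ∃ δ : ENNReal, 0 < δ ∧ ∀ Ψ : Literature.MathematicalPhysics.QuantumManyBody.BoseGas.PeriodicTrialState N (Literature.MathematicalPhysics.QuantumManyBody.BoseGas.sideLength ρ N), Literature.MathematicalPhysics.QuantumManyBody.BoseGas.periodicEnergy v Ψ ≤ Literature.MathematicalPhysics.QuantumManyBody.BoseGas.periodicGroundStateEnergy v N (Literature.MathematicalPhysics.QuantumManyBody.BoseGas.sideLength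 ρ N) + δ → ∀ i : Fin N, let L : ℝ := Literature.MathematicalPhysics.QuantumManyBody.BoseGas.sideLength ρ N; let m : ℕ := ⌊L / η⌋₊; let G : EuclideanSpace ℝ (Fin 3) → ℝ := fun r => (∫ X in Literature.MathematicalPhysics.QuantumManyBody.BoseGas.cellN N L, conj (Ψ.ψ (Function.update X i (X i + r))) * Ψ.ψ X).re; ∃ c : ℝ, (∑ j : Fin 3 → Fin m, |Real.log (G (Literature.MathematicalPhysics.QuantumManyBody.BoseGas.latticeVec (L / m) (fun k => ((j k : ℕ) : ℤ)))) - c| * ((L / m) / (1 + ∑ k, ((min (j k : ℕ) (m - (j k : ℕ)) : ℕ) : ℝ) ^ 2))) ≤ C)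
    {v : ℝ → ℝ≥0∞} (hv : IsRepulsiveFiniteRange v) {M : ℝ≥0} (hM : ∀ r, v r ≤ M) :
    ∃ ρ₀ : ℝ, 0 < ρ₀ ∧ ∀ ρ : ℝ, 0 < ρ → ρ < ρ₀ →
      ∃ c : ℝ, 0 < c ∧ ∀ᶠ N : ℕ in atTop, ∃ δ : ℝ≥0∞, 0 < δ ∧
        ∀ Ψ : PeriodicTrialState N (sideLength ρ N),
          periodicEnergy v Ψ ≤ periodicGroundStateEnergy v N (sideLength ρ N) + δ →
            ENNReal.ofReal (c * N) ≤ condensateOccupation N (sideLength ρ N) Ψ.ψ :=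
  periodicBEC_clause_of_gridMeanLog_of_coherencePos hv (coherencePos_clause_of_bounded hv hM)
    (gridMeanLog_of_logClusterL1 h1 v hv) gridAverageCondensate_proof

/-- **Packaged: the crux implies `PeriodicBEC` restricted to the bounded admissible potentials**
(`BECPeriodicReduction.PeriodicBEC` with the extra hypothesis `∃ M < ∞, v ≤ M` on the potential).
[folklore] -/
theorem periodicBEC_bounded_of_levyNegativeMoment
    (h2 : Summit.AtomisticToContinuum.BoseEinsteinCondensation.Theses.BECInfDivCoherence.LevyNegativeMoment) :
    ∀ v : ℝ → ℝ≥0∞, IsRepulsiveFiniteRange v → (∃ M : ℝ≥0, ∀ r, v r ≤ M) →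
      ∃ ρ₀ : ℝ, 0 < ρ₀ ∧ ∀ ρ : ℝ, 0 < ρ → ρ < ρ₀ →
        ∃ c : ℝ, 0 < c ∧ ∀ᶠ N : ℕ in atTop, ∃ δ : ℝ≥0∞, 0 < δ ∧
          ∀ Ψ : PeriodicTrialState N (sideLength ρ N),
            periodicEnergy v Ψ ≤ periodicGroundStateEnergy v N (sideLength ρ N) + δ →
              ENNReal.ofReal (c * N) ≤ condensateOccupation N (sideLength ρ N) Ψ.ψ :=
  fun _ hv ⟨_, hM⟩ => periodicBEC_clause_of_levyNegativeMoment_bounded h2 hv hM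

/-- **On the bounded sector the sister crux is idle for the whole route.** `LevyNegativeMoment` together
with the route's boundary-condition transfer `BoundaryTransferWeak` (stmt-0827, whose hypothesis is exactly
the `PeriodicBEC` clause of `v`) already gives the summit conjunct's criterion `HasGroundStateBEC v ρ` at
all small densities for every BOUNDED admissible `v` — `GridInfDivCoherence` (stmt-9114) is not used.
[folklore] -/
theorem hasGroundStateBEC_bounded_of_levyNegativeMoment_of_boundaryTransferWeak
    (h2 : Summit.AtomisticToContinuum.BoseEinsteinCondensation.Theses.BECInfDivCoherence.LevyNegativeMoment)
    (h6 : Summit.AtomisticToContinuum.BoseEinsteinCondensation.Theses.BECInfDivCoherence.BoundaryTransferWeak) :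
    ∀ v : ℝ → ℝ≥0∞, IsRepulsiveFiniteRange v → (∃ M : ℝ≥0, ∀ r, v r ≤ M) →
      ∃ ρ₀ : ℝ, 0 < ρ₀ ∧ ∀ ρ : ℝ, 0 < ρ → ρ < ρ₀ → HasGroundStateBEC v ρ :=
  fun v hv hM => h6 v hv (periodicBEC_bounded_of_levyNegativeMoment h2 v hv hM)

end Summit.AtomisticToContinuum.BoseEinsteinCondensation.Theorems

end
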